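import Summits.BirchSwinnertonDyer.BirchSwinnertonDyer.Theorems.AdditiveBranchIMCTameSpecialization
import Summits.BirchSwinnertonDyer.BirchSwinnertonDyer.Theorems.PrintCf2RubinValueTwoTwoVariableDualTorsion
import Summits.BirchSwinnertonDyer.BirchSwinnertonDyer.Theorems.AdditiveBranchIMCTameExactControlReduction
import Summits.BirchSwinnertonDyer.BirchSwinnertonDyer.Theorems.AdditiveBranchIMCTameLocalVanishingCore

/-!
# `Λ₂`-torsion of the two-variable Greenberg dual on the tame road

Helper for the crux `GordTwoRankZeroOffCaseOne` (stmt-BirchSwinnertonDyer-19357), line `three_field_road`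
v25, registered port stub `stub_tameXGr₂TorsionR0` = hypothesis (T) of Castella–Liu–Wan, Forum Math.
Sigma 10 (2022) e110, print Thm. 8.2.1 ("we can assume `X` is torsion; otherwise its characteristic
ideal is defined to be `(0)`") for `X_Gr₂(E_K)_{𝔭′} = WeierstrassCurve.XGr₂ (W.baseChange K) p κ₁ κ 𝔭′ γ₁ γ`.

* §1 (pure algebra over `Λ₂ = Λ⟦T₁⟧`): a finitely generated `Λ₂`-module `X` with a `constantCoeff`-
  semilinear map `X ⧸ T₁X → Y` onto... (no surjectivity needed) INTO a `Λ`-torsion module `Y` whose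
  kernel is killed by `p^m` is `Λ₂`-torsion: `X ⧸ T₁X` is `Λ`-torsion (killed elementwise by `p^m·s`),
  then Cayley–Hamilton (`PrintCf2.TwoVarDualTorsion.isTorsion₂_of_linePush` with the identity push).
* §2: for `X_Gr₂` — finite generation (`SignedBaseChangeAcDivFinitePiece.xGr₂_module_finite`), the
  control map `XGr₂.toXAcQuot` with kernel of exponent `p^m` from tame exact control
  (`TameSpecialization.S2L.pow_smul_eq_zero_of_toXAcQuot_eq_zero`); on the `CellGordTwo` tame sub-row at an
  imaginary quadratic `K` with `p` split the exponent exists by `TameExactControl.tameExactControl_of_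
  localVanishing` ∘ `TameLocalVanishing.tameLocalVanishing_cellGordTwo`.
-/

set_option linter.dupNamespace false

open scoped Classical

open Function PowerSeries NumberField IsDedekindDomain Field WeierstrassCurve
  Literature.NumberTheory.GaloisRepresentations Literature.NumberTheory.EllipticCurves
  Literature.NumberTheory.EllipticCurves.Rank1Residual
  Summit.BirchSwinnertonDyer.Rank1Residual Summit.BirchSwinnertonDyer.Rank1Residual.Additive
  Summit.BirchSwinnertonDyer.BirchSwinnertonDyer.Theorems

namespace Summit.BirchSwinnertonDyer.BirchSwinnertonDyer.Theorems.TameXGr₂Torsion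

variable {K : Type} [Field K] [NumberField K] (W : WeierstrassCurve K) (p : ℕ) [Fact p.Prime]
  (κ₁ κ₂ : ZpExtension K p) (vbar : HeightOneSpectrum (𝓞 K)) (γ₁ γ₂ : absoluteGaloisGroup K)
  [Fact (ZpExtension.IsTopGeneratorPair κ₁ κ₂ γ₁ γ₂)] [Fact (κ₂.IsTopGenerator γ₂)]

/-- **`X_Gr₂` is `Λ₂`-torsion when `X_ac^∅` is `Λ`-torsion and tame exact control holds**:
the control map `X_Gr₂ ⧸ T₁ → X_ac` (`XGr₂.toXAcQuot`, `constantCoeff`-semilinear) has kernel killed by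
`p^m` (`S2L.pow_smul_eq_zero_of_toXAcQuot_eq_zero`), so every class in `X_Gr₂ ⧸ T₁X_Gr₂` is killed by some
`C(p^m·s)`, `s` a non-zero-divisor of `Λ`; `X_Gr₂` is finitely generated
(`SignedBaseChangeAcDivFinitePiece.xGr₂_module_finite`), hence `Λ₂`-torsion by Cayley–Hamilton
(`PrintCf2.TwoVarDualTorsion.isTorsion₂_of_linePush` applied to the identity of `X_Gr₂ ⧸ T₁X_Gr₂`).
[cite: SkinnerUrban2014, §3.1.6] [cite: JetchevSkinnerWan2017, §3.4 (arXiv:1512.06894 pp. 14–15)] -/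
theorem isTorsion_XGr₂_of_isTorsion_XAc [W.IsElliptic]
    (hYt : Module.IsTorsion (IwasawaAlgebra p) (X11b.AcSelmer.XAc W p κ₂ vbar ∅ γ₂))
    (hctl : ∃ m : ℕ, ∀ s : unrSelmer₂ κ₁ κ₂ (W.geomPrimaryTorsion p) vbar,
      conjSel₂ κ₁ κ₂ (W.geomPrimaryTorsion p) vbar γ₁ s = s →
        p ^ m • s ∈ Set.range (W.selmerAcToUnrSelmer₂ p κ₁ κ₂ vbar)) :
    Module.IsTorsion (IwasawaAlgebra₂ p) (W.XGr₂ p κ₁ κ₂ vbar γ₁ γ₂) := by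
  haveI : Module.Finite (IwasawaAlgebra₂ p) (W.XGr₂ p κ₁ κ₂ vbar γ₁ γ₂) :=
    SignedBaseChangeAcDivFinitePiece.xGr₂_module_finite W p κ₁ κ₂ vbar
  have hp0 : (p : IwasawaAlgebra p) ≠ 0 := by
    rw [Ne, ← map_natCast (PowerSeries.C (R := ℤ_[p])), PowerSeries.ext_iff, not_forall]
    refine ⟨0, ?_⟩
    rw [PowerSeries.coeff_C, if_pos rfl, map_zero]
    exact_mod_cast (Fact.out : p.Prime).ne_zero
  obtain ⟨m, hm⟩ := hctl
  -- `X_Gr₂ ⧸ T₁ • ⊤ ≃ X_Gr₂ ⧸ (T₁) • ⊤`, then the tree's semilinear control map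
  let e : QuotSMulTop (PowerSeries.X : IwasawaAlgebra₂ p) (W.XGr₂ p κ₁ κ₂ vbar γ₁ γ₂)
      ≃ₗ[IwasawaAlgebra₂ p] (W.XGr₂ p κ₁ κ₂ vbar γ₁ γ₂ ⧸
        (Ideal.span {(PowerSeries.X : IwasawaAlgebra₂ p)} •
          (⊤ : Submodule (IwasawaAlgebra₂ p) (W.XGr₂ p κ₁ κ₂ vbar γ₁ γ₂)))) :=
    Submodule.quotEquivOfEq _ _
      (Submodule.ideal_span_singleton_smul (PowerSeries.X : IwasawaAlgebra₂ p) ⊤).symm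
  let ψ := (WeierstrassCurve.XGr₂.toXAcQuot W p κ₁ κ₂ vbar γ₁ γ₂).comp e.toLinearMap
  letI instQ : Module (IwasawaAlgebra p)
      (QuotSMulTop (PowerSeries.X : IwasawaAlgebra₂ p) (W.XGr₂ p κ₁ κ₂ vbar γ₁ γ₂)) :=
    Module.compHom _ (PowerSeries.C (R := IwasawaAlgebra p))
  -- `X_Gr₂ ⧸ T₁X_Gr₂` is `Λ`-torsion
  have htorQ : Module.IsTorsion (IwasawaAlgebra p)
      (QuotSMulTop (PowerSeries.X : IwasawaAlgebra₂ p) (W.XGr₂ p κ₁ κ₂ vbar γ₁ γ₂)) := by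
    intro q
    obtain ⟨⟨s, hs⟩, hsq⟩ := @hYt (ψ q)
    have h1 : ψ ((PowerSeries.C s : IwasawaAlgebra₂ p) • q) = 0 := by
      rw [ψ.map_smulₛₗ, PowerSeries.constantCoeff_C]
      exact hsq
    have h2 := TameSpecialization.S2L.pow_smul_eq_zero_of_toXAcQuot_eq_zero W p κ₁ κ₂ vbar γ₁ γ₂ hm
      (e ((PowerSeries.C s : IwasawaAlgebra₂ p) • q)) h1
    have h3 : ((p : IwasawaAlgebra₂ p) ^ m * PowerSeries.C s) • q = 0 := by
      rw [mul_smul]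
      exact e.map_eq_zero_iff.mp (by rw [e.map_smul]; exact h2)
    refine ⟨⟨(p : IwasawaAlgebra p) ^ m * s, mul_mem (pow_mem (mem_nonZeroDivisors_of_ne_zero hp0) m) hs⟩, ?_⟩
    show (PowerSeries.C ((p : IwasawaAlgebra p) ^ m * s) : IwasawaAlgebra₂ p) • q = 0
    rw [map_mul, map_pow, map_natCast]
    exact h3
  -- Cayley–Hamilton over `Λ₂` with the identity push
  exact PrintCf2.TwoVarDualTorsion.isTorsion₂_of_linePush p (W.XGr₂ p κ₁ κ₂ vbar γ₁ γ₂) LinearMap.id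
    injective_id htorQ

omit [Fact (ZpExtension.IsTopGeneratorPair κ₁ κ₂ γ₁ γ₂)] [Fact (κ₂.IsTopGenerator γ₂)] in
/-- **`X_Gr₂(E_K)_{𝔭′}` is `Λ₂`-torsion on the `CellGordTwo` tame sub-row**, at an imaginary quadratic `K`
with `p` split, for every anticyclotomic datum whose `X_ac^∅(E_K)_{𝔭′}` is `Λ`-torsion and every completing
pair: `isTorsion_XGr₂_of_isTorsion_XAc` with the exponent of tame exact control (`Surj`, `p ≥ 5`)
(`TameExactControl.tameExactControl_of_localVanishing` ∘ `TameLocalVanishing.tameLocalVanishing_cellGordTwo`).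
[cite: CastellaLiuWan2022, proof of Thm. 8.2.1 p. 85 (hypothesis (T))] [cite: SkinnerUrban2014, §3.1.6] -/
theorem isTorsion_XGr₂_cellGordTwo (W : WeierstrassCurve ℚ) [W.IsElliptic] [W.IsGloballyMinimal]
    (p : ℕ) [Fact p.Prime] (K : Type) [Field K] [NumberField K] (hcell : N10.CellGordTwo W p)
    (hp5 : 5 ≤ p) (hsurj : Surj W p) (hK : IsImaginaryQuadratic K)
    (hsplitK : ((Ideal.span {(p : ℤ)}).primesOver (𝓞 K)).ncard = 2)
    (κ₁ κ : ZpExtension K p) (γ₁ γ : absoluteGaloisGroup K) [Fact (ZpExtension.IsTopGeneratorPair κ₁ κ γ₁ γ)]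
    [Fact (κ.IsTopGenerator γ)] (𝔭' : HeightOneSpectrum (𝓞 K)) (h𝔭' : ((p : ℕ) : 𝓞 K) ∈ 𝔭'.asIdeal)
    (htors : Module.IsTorsion (IwasawaAlgebra p) (X11b.AcSelmer.XAc (W.baseChange K) p κ 𝔭' ∅ γ)) :
    Module.IsTorsion (IwasawaAlgebra₂ p) ((W.baseChange K).XGr₂ p κ₁ κ 𝔭' γ₁ γ) := by
  have hp2 : p ≠ 2 := by omega
  haveI hEK : (W.baseChange K).IsElliptic := by rw [WeierstrassCurve.baseChange]; infer_instance
  have hvan : ∀ m : (W.baseChange K).geomPrimaryTorsion p, (∀ x : absoluteGaloisGroup K,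
      x ∈ ZpExtension.pairKer κ₁ κ → x ∈ GreenbergSelmer.inertia 𝔭' → x • m = m) → m = 0 :=
    fun m hm ↦ TameLocalVanishing.tameLocalVanishing_cellGordTwo W p K hcell hp5 hK.1 hsplitK κ₁ κ 𝔭' h𝔭' m hm
  obtain ⟨m, hm⟩ := TameExactControl.tameExactControl_of_localVanishing W p hp2 hsurj K hK κ₁ κ γ₁ γ 𝔭' h𝔭' hvan
  exact isTorsion_XGr₂_of_isTorsion_XAc (W.baseChange K) p κ₁ κ 𝔭' γ₁ γ htors ⟨m, hm⟩

end Summit.BirchSwinnertonDyer.BirchSwinnertonDyer.Theorems.TameXGr₂Torsion
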